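import Summits.ResolutionOfSingularities.ResolutionOfSingularities.Theorems.WeightedInvariantDescentPerfectToAllKummerCriterion
import Literature.AlgebraicGeometry.Resolution.CompletedPullbackRegular
import Mathlib

/-!
# `DescentPerfectToAll` — negative lemma: wounds are inherited (no robust resolution of a wounded scheme)

Support (negative) lemma for crux `stmt-ResolutionOfSingularities-0549`
(`Summit.ResolutionOfSingularities.ResolutionOfSingularities.Theses.Descent.DescentPerfectToAll` and
its rfl-equal route copies); OURS, kernel form of `Cruxes/DescentPerfectToAll/STRATEGY-CENSUS.md`
§2.3 (a) ("a defect at a point of a model is inherited by EVERY model dominating it … robust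
models, if any, sit LOW; 'resolve more' never repairs"), companion of
`OneRootRobustAtFixedLevelFalse.lean` (the typed target `OneRootRobustAtFixedLevel` refuted by the
wounded point `Spec k(t^{1/p})`).

Setting: `k` a field of characteristic `p`, `K = k(α)` with `α^p = a ∉ k^p` (one `p`-th root of a
constant — the step of the crux's one-root reduction F″), `f : X → Spec k`. A point `x ∈ X` is
WOUNDED (for the root `a^{1/p}`) if the constant `a`, read in `𝒪_{X,x}` through `f`, is a `p`-th
power modulo `𝔪_x²`. By the Kummer criterion (`stub_kummerCriterion`,
`Theorems/WeightedInvariantDescentPerfectToAllKummerCriterion.lean`, p104053) a REGULAR wounded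
point is exactly a regular point over which `X ×ₖ K` is not regular.

## Results (all sorry-free, no new definitions)

* `nonempty_rootAlgEquiv`, `exists_algebraMap_eq_pow`, `nonempty_baseChangeRootAlgEquiv`,
  `exists_pow_eq_tmul_one` — `K ≅ k[X]/(X^p - a)`, `K^p ⊆ k`, `B ⊗ₖ K ≅ B[X]/(X^p - a)`,
  `(B ⊗ₖ K)^p ⊆ B ⊗ 1`.
* `not_isRegularLocalRing_localization_baseChange_of_wound` — RING FORM: for a prime `𝔓` of
  `B ⊗ₖ K` over `𝔭 ⊂ B` with `O = B_𝔭` regular and wounded, `(B ⊗ₖ K)_𝔓` is not regular. Proof: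
  `(B ⊗ₖ K)_𝔓` is a localisation of `S = (B ∖ 𝔭)⁻¹(B ⊗ₖ K) ≅ O ⊗ₖ K ≅ O[X]/(X^p - a)` at elements
  that are already units (`s ∉ 𝔓 ⇒ s^p ∈ (B ∖ 𝔭) ⊗ 1`), hence isomorphic to `O[X]/(X^p - a)`,
  which the Kummer criterion declares non-regular.
* `not_isRegular_pullback_of_wound` — SCHEME FORM: a regular wounded point `y` of a `k`-scheme
  `Y` makes `Y ×_{Spec k} Spec K` non-regular (affine chart `Spec (Γ(Y, W) ⊗ₖ K)` of the base
  change, tree `Literature…specTensorChart`; `𝒪_{Y,y}` is the localisation of `Γ(Y, W)`).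
* `not_isRegular_pullback_of_wound_of_hom` — INHERITANCE: if `X` is wounded at `π(y)` and
  `𝒪_{Y,y}` is regular, `Y ×ₖ K` is not regular (the local map `𝒪_{X,π y} → 𝒪_{Y,y}` carries
  `a ≡ c^p (mod 𝔪²)` along).
* `not_isRegular_pullback_of_isBirational_of_wound` — NO ROBUST RESOLUTION AT THE WOUNDED LEVEL:
  for `X` wounded at any point and every universally closed birational `π : Y → X` with `Y`
  regular, `Y ×ₖ K` is not regular (`π` is surjective).

WHAT THIS SAYS FOR THE CRUX (mechanism, not statement). In the UP-direction of F″ (adjoin one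
`p`-th root, resolve at the lower level, hope the resolution stays regular) a model wounded
ANYWHERE has no robust resolution; witnesses: the point `Spec K` (`X ×ₖ K` non-reduced), Kollár's
curve `y² = x^p - t` (`X ×ₖ K` reduced, not normal) and the regular chart `x^p - μ = y a` of the
minimal resolution of `{yz = (x^p - μ)²}` (STRATEGY-CENSUS §2.4; `X ×ₖ K` the NORMAL `A_{p-1}`
point `v^p = y a`). The census's sharper statement (the UNWOUNDED cotangent-stable cone itself has
no robust resolution, every resolution factoring through the wounded minimal one) needs
domination of minimal resolutions and is NOT formalised here. Nothing here bears on the crux or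
the summit as stated.

Sources: STRATEGY-CENSUS.md §2.3–§2.4 (this tree); Matsumura, CRT, Thm. 14.2; Kollár 2007, 1.19.
-/

noncomputable section

open CategoryTheory CategoryTheory.Limits AlgebraicGeometry TopologicalSpace
open Polynomial TensorProduct IsLocalRing
open Literature.AlgebraicGeometry.Resolution

set_option linter.dupNamespace false -- mandated namespace `…ResolutionOfSingularities.ResolutionOfSingularities…` of this single-conjunct summit

namespace Summit.ResolutionOfSingularities.ResolutionOfSingularities.Theorems.DescentPerfectToAll.Negative

/-! ## §1 The one-root extension `K = k(α)`, `α^p = a ∉ k^p` -/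

section OneRoot

variable {k K : Type} [Field k] [Field K] [Algebra k K] {p : ℕ} [Fact p.Prime]

/-- For `a ∉ k^p` the Kummer polynomial `X^p - a` is the minimal polynomial of any of its roots.
[folklore] -/
theorem minpoly_eq_X_pow_sub_C {a : k} {α : K} (ha : ∀ b : k, b ^ p ≠ a)
    (hα : α ^ p = algebraMap k K a) : minpoly k α = X ^ p - C a := by
  refine (minpoly.eq_of_irreducible_of_monic (X_pow_sub_C_irreducible_of_prime Fact.out ha) ?_
    (monic_X_pow_sub_C a (Fact.out : p.Prime).ne_zero)).symm
  simp [hα]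

/-- `K = k(α)` with `α^p = a ∉ k^p` is `k[X]/(X^p - a)` as a `k`-algebra. [folklore] -/
theorem nonempty_rootAlgEquiv {a : k} {α : K} (ha : ∀ b : k, b ^ p ≠ a)
    (hα : α ^ p = algebraMap k K a) (hgen : IntermediateField.adjoin k {α} = ⊤) :
    Nonempty (AdjoinRoot (X ^ p - C a : k[X]) ≃ₐ[k] K) :=
  have hint : IsIntegral k α := ⟨X ^ p - C a, monic_X_pow_sub_C a (Fact.out : p.Prime).ne_zero,
    by simp [hα]⟩
  ⟨(AdjoinRoot.algEquivOfEq k _ _ (minpoly_eq_X_pow_sub_C ha hα).symm).trans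
    ((IntermediateField.adjoinRootEquivAdjoin k hint).trans
      ((IntermediateField.equivOfEq hgen).trans IntermediateField.topEquiv))⟩

/-- In `K = k(α)`, `α^p = a`, every `p`-th power lies in `k` (Frobenius is additive).
[folklore] -/
theorem exists_algebraMap_eq_pow [CharP k p] {a : k} {α : K} (hα : α ^ p = algebraMap k K a)
    (hgen : IntermediateField.adjoin k {α} = ⊤) (x : K) : ∃ y : k, algebraMap k K y = x ^ p := by
  haveI : CharP K p := charP_of_injective_algebraMap (algebraMap k K).injective p
  have hint : IsIntegral k α := ⟨X ^ p - C a, monic_X_pow_sub_C a (Fact.out : p.Prime).ne_zero,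
    by simp [hα]⟩
  have hx : x ∈ Algebra.adjoin k {α} := by
    rw [← IntermediateField.adjoin_simple_toSubalgebra_of_isAlgebraic hint.isAlgebraic, hgen]
    trivial
  induction hx using Algebra.adjoin_induction with
  | mem x hx =>
    rw [Set.mem_singleton_iff] at hx
    subst hx
    exact ⟨a, hα.symm⟩
  | algebraMap r => exact ⟨r ^ p, by rw [map_pow]⟩
  | add x y _ _ hx hy =>
    obtain ⟨u, hu⟩ := hx
    obtain ⟨v, hv⟩ := hy
    exact ⟨u + v, by rw [map_add, hu, hv, add_pow_char]⟩
  | mul x y _ _ hx hy =>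
    obtain ⟨u, hu⟩ := hx
    obtain ⟨v, hv⟩ := hy
    exact ⟨u * v, by rw [map_mul, hu, hv, mul_pow]⟩

end OneRoot

/-! ## §2 Base change of a `k`-algebra along `k → K`: `B ⊗ₖ K ≅ B[X]/(X^p - a)` -/

section BaseChange

variable {k K : Type} [Field k] [Field K] [Algebra k K] {p : ℕ} [Fact p.Prime]
variable (B : Type) [CommRing B] [Algebra k B]

/-- For `K = k(α)`, `α^p = a ∉ k^p`, and any `k`-algebra `B`:
`B ⊗ₖ K ≅ B[X]/(X^p - a)` as `B`-algebras (base change of root adjunction, Mathlib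
`AdjoinRoot.tensorAlgEquiv`). [folklore] -/
theorem nonempty_baseChangeRootAlgEquiv {a : k} {α : K} (ha : ∀ b : k, b ^ p ≠ a)
    (hα : α ^ p = algebraMap k K a) (hgen : IntermediateField.adjoin k {α} = ⊤) :
    Nonempty (B ⊗[k] K ≃ₐ[B] AdjoinRoot (X ^ p - C (algebraMap k B a) : B[X])) :=
  let ⟨eK⟩ := nonempty_rootAlgEquiv ha hα hgen
  let f : k[X] := X ^ p - C a
  let q : (B ⊗[k] k)[X] :=
    f.map (Algebra.TensorProduct.includeRight : k →ₐ[k] B ⊗[k] k).toRingHom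
  have hq : (q.map (Algebra.TensorProduct.rid k B B : B ⊗[k] k →+* B)) =
      X ^ p - C (algebraMap k B a) := by
    simp only [q, f, Polynomial.map_sub, Polynomial.map_pow, map_X, map_C]
    congr 2
    change (Algebra.TensorProduct.rid k B B) ((1 : B) ⊗ₜ[k] a) = algebraMap k B a
    rw [Algebra.TensorProduct.rid_tmul, Algebra.algebraMap_eq_smul_one]
  ⟨(Algebra.TensorProduct.congr (AlgEquiv.refl : B ≃ₐ[B] B) eK.symm).trans
    ((AdjoinRoot.tensorAlgEquiv f q rfl).trans
      (AdjoinRoot.mapAlgEquiv (Algebra.TensorProduct.rid k B B) q _ (by rw [← hq])))⟩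

/-- Frobenius on `B ⊗ₖ K`: every `p`-th power lies in `B ⊗ 1`. [folklore] -/
theorem exists_pow_eq_tmul_one [CharP k p] {a : k} {α : K} (hα : α ^ p = algebraMap k K a)
    (hgen : IntermediateField.adjoin k {α} = ⊤) [CharP (B ⊗[k] K) p] (s : B ⊗[k] K) :
    ∃ b : B, s ^ p = b ⊗ₜ[k] 1 := by
  induction s using TensorProduct.induction_on with
  | zero => exact ⟨0, by rw [zero_pow (Fact.out : p.Prime).ne_zero, zero_tmul]⟩
  | tmul b x =>
    obtain ⟨y, hy⟩ := exists_algebraMap_eq_pow hα hgen x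
    refine ⟨y • b ^ p, ?_⟩
    rw [Algebra.TensorProduct.tmul_pow, ← hy, Algebra.algebraMap_eq_smul_one, tmul_smul,
      smul_tmul']
  | add s t hs ht =>
    obtain ⟨b, hb⟩ := hs
    obtain ⟨c, hc⟩ := ht
    exact ⟨b + c, by rw [add_pow_char, hb, hc, add_tmul]⟩

end BaseChange

/-! ## §3 Local rings of the base change: `(B ⊗ₖ K)_𝔓 ≅ B_𝔭[X]/(X^p - a)` and the wound -/

section Localization

variable {k K : Type} [Field k] [Field K] [Algebra k K] {p : ℕ} [Fact p.Prime]
variable {B : Type} [CommRing B] [Algebra k B]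

/-- **Wounds kill regularity of the base change, ring form.** Let `K = k(α)`, `α^p = a ∉ k^p`,
`B` a `k`-algebra, `𝔭 ⊂ B` a prime with local ring `O = B_𝔭` (any localisation of `B` at `𝔭`,
compatibly a `k`-algebra), and `𝔓` a prime of `B ⊗ₖ K` over `𝔭`. If `O` is a regular local ring
in which `a ≡ c^p (mod 𝔪_O²)` for some `c` (a WOUND at `𝔭` for the root `a^{1/p}`), then the
local ring `(B ⊗ₖ K)_𝔓` is NOT regular. Indeed `(B ⊗ₖ K)_𝔓 ≅ O ⊗ₖ K ≅ O[X]/(X^p - a)` (the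
middle ring is already local: every `s ∉ 𝔓` has `s^p ∈ B ⊗ 1` outside `𝔭 ⊗ 1`, hence becomes a
unit there), and the Kummer criterion (`stub_kummerCriterion`, landed p104053) says that
`O[X]/(X^p - a)` is regular iff `a - c^p ∉ 𝔪_O²` for every `c`. [folklore] -/
theorem not_isRegularLocalRing_localization_baseChange_of_wound [CharP k p] {a : k} {α : K}
    (ha : ∀ b : k, b ^ p ≠ a) (hα : α ^ p = algebraMap k K a)
    (hgen : IntermediateField.adjoin k {α} = ⊤) (𝔭 : Ideal B) [𝔭.IsPrime]
    (O : Type) [CommRing O] [Algebra B O] [Algebra k O] [IsScalarTower k B O]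
    [IsLocalization.AtPrime O 𝔭] [IsRegularLocalRing O]
    (hwound : ∃ c : O, algebraMap k O a - c ^ p ∈ (maximalIdeal O) ^ 2)
    (𝔓 : Ideal (B ⊗[k] K)) [𝔓.IsPrime] (h𝔓 : 𝔓.comap (algebraMap B (B ⊗[k] K)) = 𝔭) :
    ¬ IsRegularLocalRing (Localization.AtPrime 𝔓) := by
  have hp : p.Prime := Fact.out
  -- non-triviality and characteristic
  haveI : Nontrivial (B ⊗[k] K) := by
    by_contra h
    rw [not_nontrivial_iff_subsingleton] at h
    exact Ideal.IsPrime.ne_top' (Subsingleton.elim 𝔓 ⊤)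
  haveI : CharP (B ⊗[k] K) p :=
    charP_of_injective_algebraMap (algebraMap k (B ⊗[k] K)).injective p
  haveI : CharP O p := charP_of_injective_algebraMap (algebraMap k O).injective p
  -- the intermediate localisation `S = (B ∖ 𝔭)⁻¹ (B ⊗ₖ K)`
  set M : Submonoid B := 𝔭.primeCompl with hM
  set M' : Submonoid (B ⊗[k] K) := Algebra.algebraMapSubmonoid (B ⊗[k] K) M with hM'
  have hle : M' ≤ 𝔓.primeCompl := by
    rintro _ ⟨b, hb, rfl⟩
    intro hb'
    apply hb
    show b ∈ 𝔭
    rw [← h𝔓, Ideal.mem_comap]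
    exact hb'
  set S := Localization M' with hS
  set T := Localization.AtPrime 𝔓 with hT
  letI : Algebra S T := IsLocalization.localizationAlgebraOfSubmonoidLe S T M' 𝔓.primeCompl hle
  haveI : IsScalarTower (B ⊗[k] K) S T :=
    IsLocalization.localization_isScalarTower_of_submonoid_le S T M' 𝔓.primeCompl hle
  haveI hTS : IsLocalization (𝔓.primeCompl.map (algebraMap (B ⊗[k] K) S)) T :=
    IsLocalization.isLocalization_of_submonoid_le S T M' 𝔓.primeCompl hle
  -- every `s ∉ 𝔓` is already a unit in `S` (Frobenius: `s^p ∈ B ⊗ 1`, outside `𝔭 ⊗ 1`)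
  have hunits : 𝔓.primeCompl.map (algebraMap (B ⊗[k] K) S) ≤ IsUnit.submonoid S := by
    rintro _ ⟨s, hs, rfl⟩
    obtain ⟨b, hb⟩ := exists_pow_eq_tmul_one B hα hgen s
    have hbM : b ∈ M := by
      intro hb𝔭
      apply hs
      have h1 : s ^ p ∈ 𝔓 := by
        rw [hb]
        have : b ∈ 𝔓.comap (algebraMap B (B ⊗[k] K)) := by rw [h𝔓]; exact hb𝔭
        exact this
      exact Ideal.IsPrime.mem_of_pow_mem inferInstance p h1
    have hmem : (b ⊗ₜ[k] (1 : K)) ∈ M' := ⟨b, hbM, rfl⟩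
    have hu : IsUnit (algebraMap (B ⊗[k] K) S (b ⊗ₜ[k] 1)) :=
      IsLocalization.map_units S (⟨b ⊗ₜ[k] 1, hmem⟩ : M')
    rw [← hb, map_pow] at hu
    exact (isUnit_pow_iff hp.ne_zero).mp hu
  let eST : S ≃ₐ[S] T :=
    IsLocalization.atUnits S (𝔓.primeCompl.map (algebraMap (B ⊗[k] K) S)) hunits
  -- `S ≅ (B ⊗ₖ K) ⊗_B O ≅ O ⊗ₖ K ≅ O[X]/(X^p - a)`
  let e₁ : S ≃ₐ[B ⊗[k] K] (B ⊗[k] K) ⊗[B] O :=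
    IsLocalization.algEquiv M' S ((B ⊗[k] K) ⊗[B] O)
  let e₂ : (B ⊗[k] K) ⊗[B] O ≃ₐ[B] O ⊗[B] (B ⊗[k] K) := Algebra.TensorProduct.comm B (B ⊗[k] K) O
  let e₃ : O ⊗[B] (B ⊗[k] K) ≃ₐ[O] O ⊗[k] K := Algebra.TensorProduct.cancelBaseChange k B O O K
  obtain ⟨e₄⟩ := nonempty_baseChangeRootAlgEquiv O ha hα hgen
  let e : T ≃+* AdjoinRoot (X ^ p - C (algebraMap k O a) : O[X]) :=
    eST.symm.toRingEquiv.trans (e₁.toRingEquiv.trans (e₂.toRingEquiv.trans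
      (e₃.toRingEquiv.trans e₄.toRingEquiv)))
  -- the Kummer criterion at the wound
  intro hTreg
  haveI := hTreg
  have hA : IsRegularLocalRing (AdjoinRoot (X ^ p - C (algebraMap k O a) : O[X])) :=
    IsRegularLocalRing.of_ringEquiv e
  obtain ⟨c, hc⟩ := hwound
  exact (stub_kummerCriterion p O (algebraMap k O a)).mp hA c hc

end Localization

/-! ## §4 Scheme form: a wounded regular point kills regularity of `Y ×ₖ K` -/

section SchemeLevel

variable {k K : Type} [Field k] [Field K] [Algebra k K] {p : ℕ} [Fact p.Prime] [CharP k p]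

/-- **A wound at a regular point of `Y` makes `Y ×ₖ Spec K` non-regular.** Let `K = k(α)`,
`α^p = a ∉ k^p`, `q : Y → Spec k` a `k`-scheme, and `y ∈ Y` a point with regular local ring in
which the constant `a` is a `p`-th power modulo `𝔪_y²` (`a ≡ c^p`, a WOUND at `y` for the root
`a^{1/p}`; the constant is read in `𝒪_{Y,y}` through `q`). Then `Y ×_{Spec k} Spec K` is not a
regular scheme: at the (unique) point over `y` its local ring is `𝒪_{Y,y}[X]/(X^p - a)`, not
regular by the Kummer criterion. Affine-locally this is
`not_isRegularLocalRing_localization_baseChange_of_wound` in the chart `Spec (Γ(Y, W) ⊗ₖ K)`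
(`Literature…specTensorChart`). [folklore] -/
theorem not_isRegular_pullback_of_wound {a : k} {α : K} (ha : ∀ b : k, b ^ p ≠ a)
    (hα : α ^ p = algebraMap k K a) (hgen : IntermediateField.adjoin k {α} = ⊤)
    {Y : Scheme.{0}} (q : Y ⟶ Spec (.of k)) (y : Y) (hy : IsRegularLocalRing (Y.presheaf.stalk y))
    (hwound : ∃ c : Y.presheaf.stalk y,
      (Y.presheaf.germ ⊤ y trivial).hom (q.appTop.hom ((Scheme.ΓSpecIso (.of k)).inv.hom a)) -
        c ^ p ∈ (maximalIdeal (Y.presheaf.stalk y)) ^ 2) :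
    ¬ Scheme.IsRegular (pullback q (Spec.map (CommRingCat.ofHom (algebraMap k K)))) := by
  intro hreg
  have hp : p.Prime := Fact.out
  -- an affine chart `W ∋ y`, with its `k`-algebra structure read through `q`
  obtain ⟨W, hWaff, hyW, -⟩ :=
    exists_isAffineOpen_mem_and_subset (X := Y) (x := y) (U := ⊤) trivial
  let iW : Spec Γ(Y, W) ⟶ Y := hWaff.fromSpec
  let φ : CommRingCat.of k ⟶ Γ(Y, W) := (Scheme.ΓSpecIso (.of k)).inv ≫ q.appLE ⊤ W le_top
  letI : Algebra k Γ(Y, W) := φ.hom.toAlgebra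
  have hi : iW ≫ q = Spec.map (CommRingCat.ofHom (algebraMap k Γ(Y, W))) := by
    rw [RingHom.algebraMap_toAlgebra, CommRingCat.ofHom_hom, Spec.map_comp,
      ← Scheme.isoSpec_Spec_inv, ← IsAffineOpen.fromSpec_top,
      IsAffineOpen.SpecMap_appLE_fromSpec q (isAffineOpen_top _) hWaff]
  -- the local ring at `y` as a localisation of the chart ring, compatibly over `k`
  letI : Algebra Γ(Y, W) (Y.presheaf.stalk y) :=
    TopCat.Presheaf.algebra_section_stalk Y.presheaf ⟨y, hyW⟩
  letI : Algebra k (Y.presheaf.stalk y) :=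
    ((algebraMap Γ(Y, W) (Y.presheaf.stalk y)).comp (algebraMap k Γ(Y, W))).toAlgebra
  haveI : IsScalarTower k Γ(Y, W) (Y.presheaf.stalk y) :=
    IsScalarTower.of_algebraMap_eq (fun _ => rfl)
  haveI : IsLocalization.AtPrime (Y.presheaf.stalk y) (hWaff.primeIdealOf ⟨y, hyW⟩).asIdeal :=
    hWaff.isLocalization_stalk ⟨y, hyW⟩
  haveI : IsRegularLocalRing (Y.presheaf.stalk y) := hy
  have ha_stalk : algebraMap k (Y.presheaf.stalk y) a =
      (Y.presheaf.germ ⊤ y trivial).hom (q.appTop.hom ((Scheme.ΓSpecIso (.of k)).inv.hom a)) := by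
    change (Y.presheaf.germ W y hyW).hom ((q.appLE ⊤ W le_top).hom
      ((Scheme.ΓSpecIso (.of k)).inv.hom a)) = _
    rw [Scheme.Hom.appLE, CommRingCat.comp_apply,
      ← CommRingCat.comp_apply _ (Y.presheaf.germ W y hyW), TopCat.Presheaf.germ_res]
    rfl
  have hwound' : ∃ c : Y.presheaf.stalk y,
      algebraMap k _ a - c ^ p ∈ (maximalIdeal _) ^ 2 := by
    obtain ⟨c, hc⟩ := hwound
    exact ⟨c, by rw [ha_stalk]; exact hc⟩
  -- `K/k` is finite, so `Γ(Y, W) ⊗ₖ K` is integral over `Γ(Y, W)`: a prime over `𝔭_y`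
  haveI : FiniteDimensional k (AdjoinRoot (X ^ p - C a : k[X])) :=
    (AdjoinRoot.powerBasis (monic_X_pow_sub_C a hp.ne_zero).ne_zero).finite
  haveI : FiniteDimensional k K := by
    obtain ⟨eK⟩ := nonempty_rootAlgEquiv ha hα hgen
    exact LinearEquiv.finiteDimensional eK.toLinearEquiv
  haveI : Algebra.IsIntegral k K := Algebra.IsIntegral.of_finite k K
  haveI : Algebra.IsIntegral Γ(Y, W) (Γ(Y, W) ⊗[k] K) :=
    Algebra.IsIntegral.tensorProduct k Γ(Y, W) K
  set 𝔭₀ := hWaff.primeIdealOf ⟨y, hyW⟩ with h𝔭₀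
  have hinj : Function.Injective (algebraMap Γ(Y, W) (Γ(Y, W) ⊗[k] K)) :=
    Algebra.TensorProduct.includeLeft_injective (S := Γ(Y, W)) (algebraMap k K).injective
  obtain ⟨𝔓, -, h𝔓prime, h𝔓⟩ := Ideal.exists_ideal_over_prime_of_isIntegral 𝔭₀.asIdeal
    (⊥ : Ideal (Γ(Y, W) ⊗[k] K)) (by
      rw [Ideal.comap_bot_of_injective _ hinj]
      exact bot_le)
  -- the point of `Y ×ₖ K` over `y` in the chart `Spec (Γ(Y, W) ⊗ₖ K)`
  let ζ : ↥(Spec (CommRingCat.of (Γ(Y, W) ⊗[k] K))) := ⟨𝔓, h𝔓prime⟩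
  have hz := hreg (specTensorChart K q iW hi ζ)
  rw [isRegularLocalRing_stalk_iff_of_isOpenImmersion (specTensorChart K q iW hi) ζ,
    isRegularLocalRing_stalk_Spec_iff] at hz
  exact not_isRegularLocalRing_localization_baseChange_of_wound ha hα hgen 𝔭₀.asIdeal
    (Y.presheaf.stalk y) hwound' 𝔓 h𝔓 hz


/-- **Wounds are inherited along morphisms** (STRATEGY-CENSUS §2.3 (a): a defect at a point of a
model is inherited by every model dominating it). Let `K = k(α)`, `α^p = a ∉ k^p`,
`f : X → Spec k`, `π : Y → X`, `y ∈ Y` with regular local ring, and suppose `X` is WOUNDED at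
`π(y)`: `a ≡ c^p (mod 𝔪²_{π(y)})` for some `c ∈ 𝒪_{X,π(y)}`. Then `Y ×_{Spec k} Spec K` is not
regular — the local homomorphism `𝒪_{X,π(y)} → 𝒪_{Y,y}` carries the congruence to `𝒪_{Y,y}`.
[folklore] -/
theorem not_isRegular_pullback_of_wound_of_hom {a : k} {α : K} (ha : ∀ b : k, b ^ p ≠ a)
    (hα : α ^ p = algebraMap k K a) (hgen : IntermediateField.adjoin k {α} = ⊤)
    {X Y : Scheme.{0}} (f : X ⟶ Spec (.of k)) (π : Y ⟶ X) (y : Y)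
    (hy : IsRegularLocalRing (Y.presheaf.stalk y))
    (hwound : ∃ c : X.presheaf.stalk (π y),
      (X.presheaf.germ ⊤ (π y) trivial).hom (f.appTop.hom ((Scheme.ΓSpecIso (.of k)).inv.hom a)) -
        c ^ p ∈ (maximalIdeal (X.presheaf.stalk (π y))) ^ 2) :
    ¬ Scheme.IsRegular (pullback (π ≫ f) (Spec.map (CommRingCat.ofHom (algebraMap k K)))) := by
  refine not_isRegular_pullback_of_wound ha hα hgen (π ≫ f) y hy ?_
  obtain ⟨c, hc⟩ := hwound
  let φ : X.presheaf.stalk (π y) →+* Y.presheaf.stalk y := (π.stalkMap y).hom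
  refine ⟨φ c, ?_⟩
  have hgerm : (Y.presheaf.germ ⊤ y trivial).hom ((π ≫ f).appTop.hom
      ((Scheme.ΓSpecIso (.of k)).inv.hom a)) =
      φ ((X.presheaf.germ ⊤ (π y) trivial).hom
        (f.appTop.hom ((Scheme.ΓSpecIso (.of k)).inv.hom a))) := by
    rw [Scheme.Hom.comp_appTop, CommRingCat.comp_apply]
    exact (Scheme.Hom.germ_stalkMap_apply π ⊤ y trivial _).symm
  rw [hgerm, ← map_pow, ← map_sub]
  have hle : (maximalIdeal (X.presheaf.stalk (π y))).map φ ≤ maximalIdeal (Y.presheaf.stalk y) :=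
    Ideal.map_le_iff_le_comap.mpr fun m hm => map_nonunit φ m hm
  have h2 := Ideal.mem_map_of_mem φ hc
  rw [Ideal.map_pow] at h2
  exact Ideal.pow_right_mono hle 2 h2

/-- **No resolution of a wounded `k`-scheme is robust at the same level** (the inheritance
principle behind STRATEGY-CENSUS §2.3 (a) / §2.4, kernel form). Let `K = k(α)`, `α^p = a ∉ k^p`,
and let `f : X → Spec k` be wounded at some point `x` (`a ≡ c^p (mod 𝔪_x²)`). Then for EVERY
universally closed (e.g. proper) birational `π : Y → X` with `Y` regular, the base change
`Y ×_{Spec k} Spec K` is NOT regular: `π` is surjective (its image is closed and contains a dense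
open), and the wound is inherited by any point over `x`. In particular the `def`
`OneRootRobustAtFixedLevel` of `Cruxes/DescentPerfectToAll/NegativeTarget_cstrat_p1.lean` fails at
every wounded `X`, whatever `X ×ₖ K` looks like (non-reduced: `Spec K`,
`OneRootRobustAtFixedLevelFalse.lean`; reduced non-normal: Kollár's curve `y² = x^p - t`,
`Literature.Barriers.ResolutionOfSingularities.RegularNotGeometricallyRegular`; normal: the regular
surface `x^p - μ = y a` of STRATEGY-CENSUS §2.4, whose base change is the `A_{p-1}` singularity
`v^p = y a`). [folklore] -/
theorem not_isRegular_pullback_of_isBirational_of_wound {a : k} {α : K}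
    (ha : ∀ b : k, b ^ p ≠ a) (hα : α ^ p = algebraMap k K a)
    (hgen : IntermediateField.adjoin k {α} = ⊤) {X : Scheme.{0}} (f : X ⟶ Spec (.of k)) (x : X)
    (hwound : ∃ c : X.presheaf.stalk x,
      (X.presheaf.germ ⊤ x trivial).hom (f.appTop.hom ((Scheme.ΓSpecIso (.of k)).inv.hom a)) -
        c ^ p ∈ (maximalIdeal (X.presheaf.stalk x)) ^ 2)
    {Y : Scheme.{0}} (π : Y ⟶ X) [UniversallyClosed π] (hbir : IsBirational π)
    (hY : Scheme.IsRegular Y) :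
    ¬ Scheme.IsRegular (pullback (π ≫ f) (Spec.map (CommRingCat.ofHom (algebraMap k K)))) := by
  -- `π` is surjective: its image is closed and contains the dense open over which it is an iso
  have hsurj : Function.Surjective π := by
    obtain ⟨U, hU, -, hiso⟩ := hbir
    intro x'
    have hcl : IsClosed (Set.range π) := π.isClosedMap.isClosed_range
    have hsub : (U : Set X) ⊆ Set.range π := by
      intro u hu
      obtain ⟨z, hz⟩ := (inferInstance : Surjective (π ∣_ U)).1 ⟨u, hu⟩
      refine ⟨z.1, ?_⟩
      have := congrArg Subtype.val hz
      rwa [morphismRestrict_base_coe] at this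
    exact (hcl.closure_subset_iff.mpr hsub) (hU x')
  obtain ⟨y, rfl⟩ := hsurj x
  exact not_isRegular_pullback_of_wound_of_hom ha hα hgen f π y (hY y) hwound

end SchemeLevel

end Summit.ResolutionOfSingularities.ResolutionOfSingularities.Theorems.DescentPerfectToAll.Negative

end
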